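import Mathlib
import HarnessLib
import Summits.Parity.BatemanHorn.Theses.VanishingDimension

/-!
# Route VanishingDimension — assembly item `Assembly` (stmt-Parity-18608)

The assembly statement of route `route-Parity-VanishingDimension` is the curried form of the route
file's deciding theorem `closes`:

`TiltedLevel → TiltCalibration → DimensionZeroSandwich → RoughTupleBound → PrimeCellExtraction →
BatemanHorn`.

Proof (pure logic, exactly `closes`): fix a Bateman–Horn system `k, f, hf`; `TiltedLevel` gives a
level exponent `θ ∈ (0, 1/4]` and a tilt threshold `z₀`; for every `ε > 0` the sandwich
`DimensionZeroSandwich` at `(θ, ε)` gives `z₁`, and for `z < min z₀ z₁` the relative level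
hypothesis feeds it; `PrimeCellExtraction` combines this family of sandwiches with the calibration
`TiltCalibration` at `θ` and the rough-tuple bound `RoughTupleBound` at `θ` into
`BatemanHornAsymptotic f`.
-/

namespace Summit.Parity.BatemanHorn.Theorems

open Summit.Parity.BatemanHorn.Theses.VanishingDimension

/-- **Assembly of route VanishingDimension** (stmt-Parity-18608): the three cruxes `TiltedLevel`,
`TiltCalibration`, `DimensionZeroSandwich` and the two supports `RoughTupleBound`,
`PrimeCellExtraction` imply `BatemanHorn`.  This is exactly the route file's deciding theorem
`closes`, curried. -/
theorem vanishingDimension_assembly_proof :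
    Summit.Parity.BatemanHorn.Theses.VanishingDimension.Assembly := by
  unfold Summit.Parity.BatemanHorn.Theses.VanishingDimension.Assembly
  intro h₁ h₂ h₃ h₄ h₅
  exact closes h₁ h₂ h₃ h₄ h₅

end Summit.Parity.BatemanHorn.Theorems
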